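import Literature.NumberTheory.Automorphic.ArchLocalTorusOrbitalCompactWall     -- FILE 1 (this brick): `isCompact_setOf_exists_conj_circleDiagonal_mem_of_blocks`, `hasCompactSupport_…_of_blocks`
import Literature.NumberTheory.Automorphic.ArchTorusOrbitalFunctionCompact      -- ★ p838154 (V2)-Q: `integral_descConj_circleDiagonal_eq_inv_smul` (fixed-quotient rider)
import HarnessLib

/-!
# The torus orbital function of `G_w = U(σ_w diag α)(ℂ)` is continuous THROUGH COMPACT WALLS (block-separated set; `N = 3`, the definite pair `{0, 2}`)
# (ROAD-Sd clause (C-cw) of the letter census of record, FILE 2 of 2; Rogawski 1990 §8.2 pp. 122–123; Shelstad 1979 §4)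

Topic `NumberTheory/Automorphic`; namespace `Literature.NumberTheory.Automorphic.UnitaryGroup`.  THEOREMS ONLY (no `def`, no instance, no notation, no axiom,
no named fact, no `sorry`).  Cell `pub/hodgecm-mathlib`, ENGINE T1 (crux H413 = `stmt-HodgeConjecture-24833`); floor-1 preparation, count-neutral, under books rows
#111 (S-d) ∕ #88 (ST-∞): ROAD-Sd map of record `CENSUS-ROAD-Sd-letters` (F0P3a-p06 (g10), 3ec10e9b) clause **(C-cw)** (LEAD DESK WORD T8-15 (C), F0P3a-plan (g9),
2026-09-01); author F0P3a-p06 (g10); per place on `archLocal L N (diagonal α) w` (desk ruling T6-84 (V7)); over FILE 1 `ArchLocalTorusOrbitalCompactWall` (joint properness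
over block-separated compacta with constant-sign blocks).

WHAT IS PROVED (`t_w(z) = ⟨circleDiagonal N z, _⟩ ∈ G_w`, labelling `b : Fin N → ι`, `hsign`: two distinct same-label coordinates have weights `re σ_w(α_i)` of the same sign).
* §3 `isOpen_setOf_blockSeparated`; **`continuousOn_integral_comp_conj_circleDiagonal_of_blocks`** — `z ↦ ∫_{G_w} f(g·t_w(z)·g⁻¹) dν(g)` is continuous on the OPEN block-separated set
  `{z | ∀ i j, b i ≠ b j → z i ≠ z j}` (`f ∈ C_c(G_w, E)`, `ν` finite on compacta; Mathlib `continuousOn_integral_of_compact_support` over FILE 1);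
  `integrable_comp_conj_circleDiagonal_of_blocks`; the fixed-quotient rider `continuousOn_integral_descConj_circleDiagonal_of_blocks` (★ p838154 unfolding).
* §4 THE COMPACT WALL (`N = 3`, `0 < re σ_w(α_0) · re σ_w(α_2)`, labelling `(0, 1, 0)`): `blockSeparated_of_ne`, `sign_of_wallLabel`,
  `isCompact_setOf_exists_conj_circleDiagonal_mem_compactWall`, **`continuousOn_integral_comp_conj_circleDiagonal_compactWall`** (continuity on the open set
  `{z | z 0 ≠ z 1 ∧ z 1 ≠ z 2}`, which CONTAINS the wall `z 0 = z 2`: print's `γ₂ → γ₀′`, centraliser `U(2) × U(1)` — no jump, no blow-up) and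
  **`continuousAt_integral_comp_conj_circleDiagonal_compactWall`**.
NOT HERE: (J-cw) (`C¹` and even across the wall — next, by import); noncompact walls (LETTERS (C-bdry)∕(J-nc)).  HONEST LABEL: HC_CM is proved only modulo the printed
citations until rung 0 closes; this file pays nothing by itself.

## References
* [Rogawski1990] J. D. Rogawski, *Automorphic Representations of Unitary Groups in Three Variables*, Ann. of Math. Stud. 123 (1990), §8.2 pp. 122–123, §1.7 p. 6, §4.9 p. 54.
* [Shelstad1979] D. Shelstad, *Characters and inner forms of a quasi-split group over ℝ*, Compositio Math. 39 (1979), §4 (orbital integrals as functions on the torus).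
* [DeitmarEchterhoff2014] A. Deitmar, S. Echterhoff, *Principles of Harmonic Analysis*, 2nd ed. (2014), Lemma 9.3.3, Cor. 1.5.4.
* [Folland1995] G. B. Folland, *A Course in Abstract Harmonic Analysis* (1995), §2.6 (2.52) (quotient by a compact subgroup).
-/

set_option autoImplicit false

noncomputable section

open MeasureTheory Measure NumberField NumberField.InfinitePlace Filter Topology Matrix
open Literature.MeasureTheory.Group
open scoped MatrixGroups ComplexConjugate

namespace Literature.NumberTheory.Automorphic.UnitaryGroup

/-! ## §3 Continuity of the torus orbital function on the block-separated set -/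

section Continuity

/-- The block-separated set `{z | b i ≠ b j → z i ≠ z j}` is open (finite intersection of `{z_i ≠ z_j}`; Hausdorff target) — like the regular set ★ `isOpen_setOf_injective`.
[cite: Rogawski1990, §3.1 p. 19] [cite: DeitmarEchterhoff2014, Lemma 9.3.3] -/
theorem isOpen_setOf_blockSeparated {κ X ι : Type*} [Finite κ] [TopologicalSpace X] [T2Space X] (b : κ → ι) :
    IsOpen {z : κ → X | ∀ i j, b i ≠ b j → z i ≠ z j} := by
  have h : {z : κ → X | ∀ i j, b i ≠ b j → z i ≠ z j} = ⋂ i : κ, ⋂ j : κ, {z | b i ≠ b j → z i ≠ z j} := by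
    ext z; simp only [Set.mem_setOf_eq, Set.mem_iInter]
  rw [h]
  refine isOpen_iInter_of_finite fun i => isOpen_iInter_of_finite fun j => ?_
  by_cases hij : b i = b j
  · have : {z : κ → X | b i ≠ b j → z i ≠ z j} = Set.univ := Set.eq_univ_of_forall fun z h => absurd hij h
    rw [this]; exact isOpen_univ
  · have : {z : κ → X | b i ≠ b j → z i ≠ z j} = {z | z i ≠ z j} := Set.ext fun z => ⟨fun h => h hij, fun h _ => h⟩
    rw [this]; exact isOpen_ne_fun (continuous_apply i) (continuous_apply j)

variable (L : Type) [Field L] (N : ℕ) (α : Fin N → L) (w : {w : InfinitePlace L // IsComplex w})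
  [MeasurableSpace (archLocal L N (Matrix.diagonal α) w)] [BorelSpace (archLocal L N (Matrix.diagonal α) w)]
  {E : Type*} [NormedAddCommGroup E]

/-- **`z ↦ ∫_{G_w} f(g·diag z·g⁻¹) dν(g)` IS CONTINUOUS ON THE BLOCK-SEPARATED SET** (constant-sign blocks; `f` continuous with compact support, `ν` finite on
compacta): on a compact neighbourhood inside the open block-separated set the integrands live in ONE compact set (§2), so Mathlib
`continuousOn_integral_of_compact_support` applies — the torus orbital function is continuous THROUGH every compact wall. [cite: Rogawski1990, §8.2 pp. 122–123]
[cite: Shelstad1979, §4] -/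
theorem continuousOn_integral_comp_conj_circleDiagonal_of_blocks [NormedSpace ℝ E] (hα : ∀ i, α i ≠ 0) (hreal : ∀ i, (w.1.embedding (α i)).im = 0)
    {ι : Type*} (b : Fin N → ι) (hsign : ∀ i j, i ≠ j → b i = b j → 0 < (w.1.embedding (α i)).re * (w.1.embedding (α j)).re)
    (ν : Measure (archLocal L N (Matrix.diagonal α) w)) [IsFiniteMeasureOnCompacts ν]
    (f : archLocal L N (Matrix.diagonal α) w → E) (hf : Continuous f) (hfc : HasCompactSupport f) :
    ContinuousOn (fun z : Fin N → Circle =>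
      ∫ g, f (g * ⟨circleDiagonal N z, circleDiagonal_mem_archLocal_diagonal L N α w z⟩ * g⁻¹) ∂ν) {z | ∀ i j, b i ≠ b j → z i ≠ z j} := by
  intro z₀ hz₀
  obtain ⟨K, hKnhds, hKsub, hK⟩ := local_compact_nhds ((isOpen_setOf_blockSeparated b).mem_nhds hz₀)
  have hS := isCompact_setOf_exists_conj_circleDiagonal_mem_of_blocks L N α w hα hreal b hsign hK hKsub hfc.isCompact
  have hcont : ContinuousOn (fun z : Fin N → Circle =>
      ∫ g, f (g * ⟨circleDiagonal N z, circleDiagonal_mem_archLocal_diagonal L N α w z⟩ * g⁻¹) ∂ν) K := by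
    refine continuousOn_integral_of_compact_support hS ?_ ?_
    · refine Continuous.continuousOn ?_
      exact hf.comp ((continuous_snd.mul (((continuous_circleDiagonal N).comp continuous_fst).subtype_mk _)).mul continuous_snd.inv)
    · intro z g hz hg
      exact image_eq_zero_of_notMem_tsupport fun h => hg ⟨z, hz, h⟩
  exact ((continuousWithinAt_iff_continuousAt hKnhds).mp (hcont z₀ (mem_of_mem_nhds hKnhds))).continuousWithinAt

/-- The conjugation integrand at a point of the block-separated set is integrable. [cite: Rogawski1990, §8.2 p. 122] -/
theorem integrable_comp_conj_circleDiagonal_of_blocks [NormedSpace ℝ E] (hα : ∀ i, α i ≠ 0) (hreal : ∀ i, (w.1.embedding (α i)).im = 0)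
    {ι : Type*} (b : Fin N → ι) (hsign : ∀ i j, i ≠ j → b i = b j → 0 < (w.1.embedding (α i)).re * (w.1.embedding (α j)).re)
    (ν : Measure (archLocal L N (Matrix.diagonal α) w)) [IsFiniteMeasureOnCompacts ν]
    {z : Fin N → Circle} (hz : ∀ i j, b i ≠ b j → z i ≠ z j)
    (f : archLocal L N (Matrix.diagonal α) w → E) (hf : Continuous f) (hfc : HasCompactSupport f) :
    Integrable (fun g : archLocal L N (Matrix.diagonal α) w =>
      f (g * ⟨circleDiagonal N z, circleDiagonal_mem_archLocal_diagonal L N α w z⟩ * g⁻¹)) ν :=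
  (hf.comp ((continuous_id.mul continuous_const).mul continuous_id.inv)).integrable_of_hasCompactSupport
    (hasCompactSupport_comp_conj_circleDiagonal_of_blocks L N α w hα hreal b hsign hz f hfc)

variable [NormedSpace ℝ E] [LocallyCompactSpace (archLocal L N (Matrix.diagonal α) w)] [SecondCountableTopology (archLocal L N (Matrix.diagonal α) w)]
  (ν : Measure (archLocal L N (Matrix.diagonal α) w)) [ν.IsHaarMeasure] [ν.IsMulRightInvariant]
  (tT : Measure ((circleDiagonal N).range.subgroupOf (archLocal L N (Matrix.diagonal α) w))) [tT.IsHaarMeasure] [tT.IsInvInvariant]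
  [MeasurableSpace (archLocal L N (Matrix.diagonal α) w ⧸ (circleDiagonal N).range.subgroupOf (archLocal L N (Matrix.diagonal α) w))]
  [BorelSpace (archLocal L N (Matrix.diagonal α) w ⧸ (circleDiagonal N).range.subgroupOf (archLocal L N (Matrix.diagonal α) w))]

/-- **THE FIXED-QUOTIENT TORUS TERM `F_f` IS CONTINUOUS ON THE BLOCK-SEPARATED SET** (★ (V2)-Q `integral_descConj_circleDiagonal_eq_inv_smul` unfolds it at every `z`;
previous theorem) — in particular through compact walls. [cite: Rogawski1990, §8.2 pp. 122–123; §1.7 p. 6] [cite: Shelstad1979, §4] -/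
theorem continuousOn_integral_descConj_circleDiagonal_of_blocks (hα : ∀ i, α i ≠ 0) (hreal : ∀ i, (w.1.embedding (α i)).im = 0)
    {ι : Type*} (b : Fin N → ι) (hsign : ∀ i j, i ≠ j → b i = b j → 0 < (w.1.embedding (α i)).re * (w.1.embedding (α j)).re)
    (f : archLocal L N (Matrix.diagonal α) w → E) (hf : Continuous f) (hfc : HasCompactSupport f) :
    ContinuousOn (fun z : Fin N → Circle =>
      ∫ y, descConj (⟨circleDiagonal N z, circleDiagonal_mem_archLocal_diagonal L N α w z⟩ : archLocal L N (Matrix.diagonal α) w)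
        ((circleDiagonal N).range.subgroupOf (archLocal L N (Matrix.diagonal α) w)) (circleTorus_comm_circleDiagonal L N α w z) f y
        ∂(quotientMeasure _ tT (isClosed_circleTorus L N α w) ν)) {z | ∀ i j, b i ≠ b j → z i ≠ z j} := by
  have h : (fun z : Fin N → Circle =>
      ∫ y, descConj (⟨circleDiagonal N z, circleDiagonal_mem_archLocal_diagonal L N α w z⟩ : archLocal L N (Matrix.diagonal α) w)
        ((circleDiagonal N).range.subgroupOf (archLocal L N (Matrix.diagonal α) w)) (circleTorus_comm_circleDiagonal L N α w z) f y
        ∂(quotientMeasure _ tT (isClosed_circleTorus L N α w) ν)) =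
      fun z => (tT.real Set.univ)⁻¹ • ∫ g, f (g * ⟨circleDiagonal N z, circleDiagonal_mem_archLocal_diagonal L N α w z⟩ * g⁻¹) ∂ν :=
    funext fun z => integral_descConj_circleDiagonal_eq_inv_smul L N α w ν tT z f hf
  rw [h]
  exact (continuousOn_integral_comp_conj_circleDiagonal_of_blocks L N α w hα hreal b hsign ν f hf hfc).const_smul _

end Continuity

/-! ## §4 The compact wall of `U(2,1)`-type places: `N = 3`, the pair `{0, 2}` of the SAME sign -/

section CompactWall

variable (L : Type) [Field L] (α : Fin 3 → L) (w : {w : InfinitePlace L // IsComplex w})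

/-- The wall labelling `b = (0, 1, 0)`: coordinates `0` and `2` form one block, `1` the other. [cite: Rogawski1990, §8.2 p. 122] -/
theorem blockSeparated_of_ne {z : Fin 3 → Circle} (h01 : z 0 ≠ z 1) (h12 : z 1 ≠ z 2) :
    ∀ i j : Fin 3, (![(0 : ℕ), 1, 0]) i ≠ (![(0 : ℕ), 1, 0]) j → z i ≠ z j := by
  intro i j
  have h10 := h01.symm
  have h21 := h12.symm
  fin_cases i <;> fin_cases j <;> simp_all

/-- On the wall labelling two distinct same-label coordinates are `0, 2`, so the sign hypothesis is `0 < e_0 e_2`. [cite: Rogawski1990, §8.2 p. 122] -/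
theorem sign_of_wallLabel (h02 : 0 < (w.1.embedding (α 0)).re * (w.1.embedding (α 2)).re) :
    ∀ i j : Fin 3, i ≠ j → (![(0 : ℕ), 1, 0]) i = (![(0 : ℕ), 1, 0]) j →
      0 < (w.1.embedding (α i)).re * (w.1.embedding (α j)).re := by
  intro i j hij hb
  fin_cases i <;> fin_cases j <;> simp_all [mul_comm]

/-- **JOINT PROPERNESS AT THE COMPACT WALL**: at a place where `re σ_w(α_0)`, `re σ_w(α_2)` have the same sign, for `K` compact inside
`{z | z 0 ≠ z 1 ∧ z 1 ≠ z 2}` (which CONTAINS the wall `z 0 = z 2`) and `C ⊆ G_w` compact, `{g | ∃ z ∈ K, g·diag z·g⁻¹ ∈ C}` is compact.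
[cite: Rogawski1990, §8.2 pp. 122–123] [cite: DeitmarEchterhoff2014, Lemma 9.3.3] -/
theorem isCompact_setOf_exists_conj_circleDiagonal_mem_compactWall (hα : ∀ i, α i ≠ 0) (hreal : ∀ i, (w.1.embedding (α i)).im = 0)
    (h02 : 0 < (w.1.embedding (α 0)).re * (w.1.embedding (α 2)).re)
    {K : Set (Fin 3 → Circle)} (hK : IsCompact K) (hKsub : K ⊆ {z | z 0 ≠ z 1 ∧ z 1 ≠ z 2})
    {C : Set (archLocal L 3 (Matrix.diagonal α) w)} (hC : IsCompact C) :
    IsCompact {g : archLocal L 3 (Matrix.diagonal α) w | ∃ z ∈ K,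
      g * ⟨circleDiagonal 3 z, circleDiagonal_mem_archLocal_diagonal L 3 α w z⟩ * g⁻¹ ∈ C} :=
  isCompact_setOf_exists_conj_circleDiagonal_mem_of_blocks L 3 α w hα hreal (![(0 : ℕ), 1, 0]) (sign_of_wallLabel L α w h02) hK
    (fun _ hz => blockSeparated_of_ne (hKsub hz).1 (hKsub hz).2) hC

variable [MeasurableSpace (archLocal L 3 (Matrix.diagonal α) w)] [BorelSpace (archLocal L 3 (Matrix.diagonal α) w)]
  {E : Type*} [NormedAddCommGroup E] [NormedSpace ℝ E]

/-- **THE TORUS ORBITAL FUNCTION IS CONTINUOUS ON `{z | z 0 ≠ z 1 ∧ z 1 ≠ z 2}` AT A PLACE WHERE THE PAIR `{0, 2}` IS DEFINITE** — an open set containing the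
compact wall `z 0 = z 2` (print's `γ₂ → γ₀′`, centraliser `U(2) × U(1)`): no jump, no blow-up there. [cite: Rogawski1990, §8.2 pp. 122–123] [cite: Shelstad1979, §4] -/
theorem continuousOn_integral_comp_conj_circleDiagonal_compactWall (hα : ∀ i, α i ≠ 0) (hreal : ∀ i, (w.1.embedding (α i)).im = 0)
    (h02 : 0 < (w.1.embedding (α 0)).re * (w.1.embedding (α 2)).re)
    (ν : Measure (archLocal L 3 (Matrix.diagonal α) w)) [IsFiniteMeasureOnCompacts ν]
    (f : archLocal L 3 (Matrix.diagonal α) w → E) (hf : Continuous f) (hfc : HasCompactSupport f) :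
    ContinuousOn (fun z : Fin 3 → Circle =>
      ∫ g, f (g * ⟨circleDiagonal 3 z, circleDiagonal_mem_archLocal_diagonal L 3 α w z⟩ * g⁻¹) ∂ν) {z | z 0 ≠ z 1 ∧ z 1 ≠ z 2} :=
  (continuousOn_integral_comp_conj_circleDiagonal_of_blocks L 3 α w hα hreal (![(0 : ℕ), 1, 0]) (sign_of_wallLabel L α w h02) ν f hf hfc).mono
    fun _ hz => blockSeparated_of_ne hz.1 hz.2

/-- **CONTINUITY AT A COMPACT-WALL POINT**: `z₀ 0 ≠ z₀ 1`, `z₀ 1 ≠ z₀ 2` (and `z₀ 0`, `z₀ 2` arbitrary — equal ON the wall). [cite: Rogawski1990, §8.2 pp. 122–123]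
[cite: Shelstad1979, §4] -/
theorem continuousAt_integral_comp_conj_circleDiagonal_compactWall (hα : ∀ i, α i ≠ 0) (hreal : ∀ i, (w.1.embedding (α i)).im = 0)
    (h02 : 0 < (w.1.embedding (α 0)).re * (w.1.embedding (α 2)).re)
    (ν : Measure (archLocal L 3 (Matrix.diagonal α) w)) [IsFiniteMeasureOnCompacts ν]
    (f : archLocal L 3 (Matrix.diagonal α) w → E) (hf : Continuous f) (hfc : HasCompactSupport f)
    {z₀ : Fin 3 → Circle} (h01 : z₀ 0 ≠ z₀ 1) (h12 : z₀ 1 ≠ z₀ 2) :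
    ContinuousAt (fun z : Fin 3 → Circle =>
      ∫ g, f (g * ⟨circleDiagonal 3 z, circleDiagonal_mem_archLocal_diagonal L 3 α w z⟩ * g⁻¹) ∂ν) z₀ := by
  have hopen : IsOpen {z : Fin 3 → Circle | z 0 ≠ z 1 ∧ z 1 ≠ z 2} :=
    (isOpen_ne_fun (continuous_apply 0) (continuous_apply 1)).inter (isOpen_ne_fun (continuous_apply 1) (continuous_apply 2))
  exact (continuousOn_integral_comp_conj_circleDiagonal_compactWall L α w hα hreal h02 ν f hf hfc).continuousAt (hopen.mem_nhds ⟨h01, h12⟩)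

end CompactWall

end Literature.NumberTheory.Automorphic.UnitaryGroup

end
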